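import Summits.AtomisticToContinuum.Crystallization.Theses.PerronTransitivity
import Summits.AtomisticToContinuum.Crystallization.Theorems.LayeredLawsSelectHcp.Negative.Threshold
import Summits.AtomisticToContinuum.Crystallization.Theorems.StackingHinge.Negative.ScaleSelection

/-!
# Negative knowledge for crux `PerronTransitivity.UniformBindingRigidity` (stmt-AtomisticToContinuum-15099):
# load-bearing hypotheses and excluded degenerate witnesses

Refuter vetting (crux-attack, `--supports stmt-AtomisticToContinuum-15099`). The crux M* reads
`∀ X ⊆ ℝ³, X.Nonempty → (X uniformly discrete) → (∀ p ∈ X, U_X(p) ≤ 2E*) → ∃ P periodic, P.points = X ∧ IsLeast (range e_LJ) (e_LJ P)`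
with `U_X(p) = ∑'_{q ∈ X, q ≠ p} V_LJ(dist p q)` and `E* = ⨅_Q e_LJ(Q)`.

* `false_without_nonempty` — dropping `X.Nonempty` makes the statement FALSE (witness `X = ∅`: every periodic
  point set is non-empty). Any proof must use non-emptiness.
* `false_without_binding` — dropping the site-binding hypothesis makes it FALSE (witness `X = {0}`: a periodic
  point set of `ℝ³` is invariant under a non-zero period — `StackingHingeNegative.exists_mem_lattice_ne_zero`, reused — `points_ne_singleton`), so the
  binding hypothesis is not decoration.
* `singleton_not_bound` — the degenerate witness `X = {x}` (where the conclusion fails) is EXCLUDED by the binding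
  hypothesis as written: its site sum is the empty `tsum = 0`, and `0 ≤ 2E*` fails because `E* ≤ −1/2`
  (`LayeredLawsSelectHcp.Negative.Threshold.eStar_le_neg_half`, item 0714's `eStar_le`). So M* is not refutable
  at `n = 1`.
* `not_bound_of_not_summable` — the `tsum` junk value cannot enter: a site whose Lennard-Jones family is not
  summable has `∑' = 0 > 2E*`, so it violates the hypothesis; every `X` admitted by M* has genuinely summable,
  strictly negative site sums.
All `[folklore]`.
-/

noncomputable section

namespace Summit.AtomisticToContinuum.Crystallization.Theorems.UniformBindingRigidity.Negative.LoadBearing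

open Literature.MathematicalPhysics.StatisticalMechanics
open Summit.AtomisticToContinuum.Crystallization.Theorems.ChargedEnergyGapNegative (eStar eStar_le)
open Summit.AtomisticToContinuum.Crystallization.Theorems.LayeredLawsSelectHcp.Negative.Threshold
  (eStar_le_neg_half)
open Summit.AtomisticToContinuum.Crystallization.Theorems.StackingHingeNegative (exists_mem_lattice_ne_zero)

/-! ## The infimum is strictly negative -/

/-- `2 · ⨅_Q e_LJ(Q) ≤ -1 < 0` (from `e* ≤ −1/2`). [folklore] -/
theorem two_mul_iInf_le_neg_one :
    2 * (⨅ Q : PeriodicConfiguration 3, Q.energyPerParticle lennardJones) ≤ -1 := by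
  have h : eStar ≤ -1 / 2 := eStar_le_neg_half
  change 2 * eStar ≤ -1
  linarith

/-! ## A periodic point set is never a singleton -/

/-- The point set of a periodic configuration of `ℝ³` is not a singleton. [folklore] -/
theorem points_ne_singleton (P : PeriodicConfiguration 3) (x : (EuclideanSpace ℝ (Fin 3))) : P.points ≠ {x} := by
  intro hx
  obtain ⟨g, hg, hg0⟩ := exists_mem_lattice_ne_zero P
  obtain ⟨y, hy⟩ := P.motif_nonempty
  have h1 : y ∈ P.points := P.mem_points_of_mem_motif hy
  have h2 : y + g ∈ P.points := P.add_mem_points h1 hg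
  rw [hx, Set.mem_singleton_iff] at h1 h2
  exact hg0 (by rw [h1] at h2; simpa using h2)

/-! ## Load-bearing hypotheses -/

/-- **M* is false without `X.Nonempty`** (witness `X = ∅`). [folklore] -/
theorem false_without_nonempty :
    ¬ (∀ X : Set (EuclideanSpace ℝ (Fin 3)), (∃ δ : ℝ, 0 < δ ∧ ∀ p ∈ X, ∀ q ∈ X, p ≠ q → δ ≤ dist p q) →
        (∀ p ∈ X, ∑' q : {q : (EuclideanSpace ℝ (Fin 3)) // q ∈ X ∧ q ≠ p}, lennardJones (dist p q.1) ≤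
          2 * ⨅ Q : PeriodicConfiguration 3, Q.energyPerParticle lennardJones) →
        ∃ P : PeriodicConfiguration 3, P.points = X ∧
          IsLeast (Set.range fun Q : PeriodicConfiguration 3 => Q.energyPerParticle lennardJones)
            (P.energyPerParticle lennardJones)) := by
  intro h
  obtain ⟨P, hP, -⟩ := h ∅ ⟨1, one_pos, fun p hp => (Set.notMem_empty p hp).elim⟩
    (fun p hp => (Set.notMem_empty p hp).elim)
  exact absurd (hP ▸ P.points_nonempty) Set.not_nonempty_empty

/-- **M* is false without the site-binding hypothesis** (witness `X = {0}`: non-empty, uniformly discrete, not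
periodic). [folklore] -/
theorem false_without_binding :
    ¬ (∀ X : Set (EuclideanSpace ℝ (Fin 3)), X.Nonempty → (∃ δ : ℝ, 0 < δ ∧ ∀ p ∈ X, ∀ q ∈ X, p ≠ q → δ ≤ dist p q) →
        ∃ P : PeriodicConfiguration 3, P.points = X ∧
          IsLeast (Set.range fun Q : PeriodicConfiguration 3 => Q.energyPerParticle lennardJones)
            (P.energyPerParticle lennardJones)) := by
  intro h
  obtain ⟨P, hP, -⟩ := h {0} (Set.singleton_nonempty 0)
    ⟨1, one_pos, fun p hp q hq hpq => (hpq (by rw [Set.mem_singleton_iff] at hp hq; rw [hp, hq])).elim⟩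
  exact points_ne_singleton P 0 hP

/-! ## Excluded degenerate witnesses -/

/-- **The `tsum` junk value cannot enter**: a site whose Lennard-Jones family over `X ∖ {p}` is not summable
violates the binding hypothesis (`∑' = 0 > 2E*`). [folklore] -/
theorem not_bound_of_not_summable {X : Set (EuclideanSpace ℝ (Fin 3))} {p : (EuclideanSpace ℝ (Fin 3))}
    (h : ¬ Summable fun q : {q : (EuclideanSpace ℝ (Fin 3)) // q ∈ X ∧ q ≠ p} => lennardJones (dist p q.1)) :
    ¬ (∑' q : {q : (EuclideanSpace ℝ (Fin 3)) // q ∈ X ∧ q ≠ p}, lennardJones (dist p q.1) ≤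
        2 * ⨅ Q : PeriodicConfiguration 3, Q.energyPerParticle lennardJones) := by
  rw [tsum_eq_zero_of_not_summable h]
  have := two_mul_iInf_le_neg_one
  intro h0
  linarith

/-- **The singleton is excluded**: `X = {x}` (non-empty, uniformly discrete, where the conclusion fails by
`points_ne_singleton`) violates the binding hypothesis, its site sum being the empty sum `0 > 2E*`. [folklore] -/
theorem singleton_not_bound (x : (EuclideanSpace ℝ (Fin 3))) :
    ¬ (∀ p ∈ ({x} : Set (EuclideanSpace ℝ (Fin 3))), ∑' q : {q : (EuclideanSpace ℝ (Fin 3)) // q ∈ ({x} : Set (EuclideanSpace ℝ (Fin 3))) ∧ q ≠ p}, lennardJones (dist p q.1) ≤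
        2 * ⨅ Q : PeriodicConfiguration 3, Q.energyPerParticle lennardJones) := by
  intro h
  have hx := h x (Set.mem_singleton x)
  haveI : IsEmpty {q : (EuclideanSpace ℝ (Fin 3)) // q ∈ ({x} : Set (EuclideanSpace ℝ (Fin 3))) ∧ q ≠ x} :=
    ⟨fun q => q.2.2 (Set.mem_singleton_iff.1 q.2.1)⟩
  rw [tsum_empty] at hx
  have := two_mul_iInf_le_neg_one
  linarith

/-- Hence the full crux hypothesis list is unsatisfiable at every singleton: M* is consistent at `n = 1` although
its conclusion fails there. [folklore] -/
theorem hypotheses_fail_at_singleton (x : (EuclideanSpace ℝ (Fin 3))) :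
    ({x} : Set (EuclideanSpace ℝ (Fin 3))).Nonempty ∧ (∃ δ : ℝ, 0 < δ ∧ ∀ p ∈ ({x} : Set (EuclideanSpace ℝ (Fin 3))), ∀ q ∈ ({x} : Set (EuclideanSpace ℝ (Fin 3))), p ≠ q → δ ≤ dist p q) ∧
      ¬ (∀ p ∈ ({x} : Set (EuclideanSpace ℝ (Fin 3))), ∑' q : {q : (EuclideanSpace ℝ (Fin 3)) // q ∈ ({x} : Set (EuclideanSpace ℝ (Fin 3))) ∧ q ≠ p}, lennardJones (dist p q.1) ≤
        2 * ⨅ Q : PeriodicConfiguration 3, Q.energyPerParticle lennardJones) ∧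
      ¬ (∃ P : PeriodicConfiguration 3, P.points = ({x} : Set (EuclideanSpace ℝ (Fin 3))) ∧
        IsLeast (Set.range fun Q : PeriodicConfiguration 3 => Q.energyPerParticle lennardJones)
          (P.energyPerParticle lennardJones)) :=
  ⟨Set.singleton_nonempty x,
    ⟨1, one_pos, fun p hp q hq hpq => (hpq (by rw [Set.mem_singleton_iff] at hp hq; rw [hp, hq])).elim⟩,
    singleton_not_bound x, fun ⟨P, hP, _⟩ => points_ne_singleton P x hP⟩

end Summit.AtomisticToContinuum.Crystallization.Theorems.UniformBindingRigidity.Negative.LoadBearing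

end
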